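import Mathlib
import Summits.NavierStokesRegularity.NavierStokesRegularity.Theorems.ThreadingFluxHorizonTowerFiniteTowerDefs
import Summits.NavierStokesRegularity.NavierStokesRegularity.Theorems.ThreadingFluxHorizonTowerFiniteTowerThreeShell
import Summits.NavierStokesRegularity.NavierStokesRegularity.Theorems.ThreadingFluxHorizonTowerFiniteTowerThirdShell
import HarnessLib

/-!
# Crux `PoloidalLiouville` (stmt-NavierStokesRegularity-1222), crux idea «horizon-threading-tower» (ns-idea-15):
# `ThreeShellMixedParityHorizonTowerZonality` (THM D) and `FiniteTowerOppositeParityHorizonTowerZonality` (THM C) BY NAME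

Support file (`--supports stmt-NavierStokesRegularity-1222`, helper; cell `ns-wall-extremal`, width hand ns-wall-eng-3 g4; 0 kit).
The typed statements (`Theorems/ThreadingFluxHorizonTowerFiniteTowerDefs.lean`, part II) are closed by name from
`threeShell_zonalForm_of_mixedParity` (`…FiniteTowerThreeShell`) and `finiteTower_zonalForm_of_oppositeParity` (`…FiniteTowerThirdShell`),
unfolding `K.max'`, `(K.erase D).max'` and `(K.filter (· % 2 ≠ D % 2)).max'` into the working binders.

HONEST LABEL: special-case theorems of the crux-idea conjecture `HorizonTowerZonality` (order one; side conditions on the top shells);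
general finite towers, general towers, `PoloidalLiouville` (1222) OPEN; W1 movement 0; NS regularity NOT proved.
-/

-- the summit and its single sub-problem share the name (CONVENTIONS §1)
set_option linter.dupNamespace false

noncomputable section

namespace Summit.NavierStokesRegularity.NavierStokesRegularity.Theorems.PoloidalLiouville.HorizonTower

open scoped RealInnerProductSpace

/-- ★★ `ThreeShellMixedParityHorizonTowerZonality` BY NAME (THM D). -/
theorem threeShellMixedParityHorizonTowerZonality : ThreeShellMixedParityHorizonTowerZonality := by
  intro l m n A B C hl hlm hmn hpar hA hhomA hharmA hB hhomB hharmB hC hhomC hharmC hA0 hB0 hC0 hL1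
  exact threeShell_zonalForm_of_mixedParity hl hlm hmn hpar hA hhomA hharmA hB hhomB hharmB hC hhomC hharmC hA0 hB0 hC0 hL1

/-- ★★ `FiniteTowerOppositeParityHorizonTowerZonality` BY NAME (THM C). -/
theorem finiteTowerOppositeParityHorizonTowerZonality : FiniteTowerOppositeParityHorizonTowerZonality := by
  intro K H hK hK' hKo hK1 hH hhom hharm hpar hD0 hD'0 ha0 hcop hL1
  set D := K.max' hK with hDdef
  set D' := (K.erase D).max' hK' with hD'def
  set a := (K.filter fun l => l % 2 ≠ D % 2).max' hKo with hadef
  have hD : D ∈ K := Finset.max'_mem K hK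
  have hmax : ∀ l ∈ K, l ≤ D := fun l hl => Finset.le_max' K l hl
  have hD'e : D' ∈ K.erase D := Finset.max'_mem _ hK'
  have hD' : D' ∈ K := Finset.mem_of_mem_erase hD'e
  have hlt : D' < D := lt_of_le_of_ne (hmax D' hD') (Finset.ne_of_mem_erase hD'e)
  have hsec : ∀ l ∈ K, l ≠ D → l ≤ D' := fun l hl hne => Finset.le_max' _ l (Finset.mem_erase.mpr ⟨hne, hl⟩)
  have haf : a ∈ K.filter fun l => l % 2 ≠ D % 2 := Finset.max'_mem _ hKo
  have haK : a ∈ K := (Finset.mem_filter.mp haf).1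
  have hapar : a % 2 ≠ D % 2 := (Finset.mem_filter.mp haf).2
  have hamax : ∀ l ∈ K, l % 2 ≠ D % 2 → l ≤ a := fun l hl hp => Finset.le_max' _ l (Finset.mem_filter.mpr ⟨hl, hp⟩)
  exact finiteTower_zonalForm_of_oppositeParity K H hK1 hH hhom hharm hL1 hD hD' hlt hmax hsec hpar haK hapar hamax hcop hD0
    hD'0 ha0

end Summit.NavierStokesRegularity.NavierStokesRegularity.Theorems.PoloidalLiouville.HorizonTower

end
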